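import Summits.NavierStokesRegularity.NavierStokesRegularity.Theorems.EpisodeBase.Negative.FirstEpisodeRFalseOfSmallDataEngine
import Summits.NavierStokesRegularity.FluidComputer.PalasekTowerTinyHosts

/-!
# `FirstEpisodeR` is false modulo the small-data classical engine

Cell `ns-blowup`, seat `ns-blowup-ecbridge-4` (g3); GROUP C «BRIDGE SUPPORT» of the route
`PalasekTowerBreakdown`, crux `EpisodeBaseG` (item stmt-NavierStokesRegularity-19179), line `birth`,
registered stub `stub_first_episodeR : FirstEpisodeR` (the ∀-schedule placeholder). LABEL: NEGATIVE
LEMMA modulo ONE typed hypothesis. WHAT THIS IS NOT: not Navier–Stokes evidence, not a refutation of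
the crux `EpisodeBaseG` (which is existential over hosts) — it says the line's ∀-placeholder stub is
false as soon as the classical small-data theory `SmallDataClassicalEngine 1` (Kato 1984) is available:
the explicit tiny anchored hosts of `PalasekTowerTinyHosts` (`tinyAnchoredHosts_holds`) discharge the
second hypothesis of `firstEpisodeR_false_of_engine_of_tinyHosts`.

* `firstEpisodeR_false_of_engine : SmallDataClassicalEngine 1 → ¬ FirstEpisodeR`;
* `firstEpisode_false_of_engine : SmallDataClassicalEngine 1 → ¬ FirstEpisode`;
* `heredityAt_zero_false_of_engine : SmallDataClassicalEngine 1 → ¬ HeredityAt 0`.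

References: S. Palasek, arXiv:2605.13827 §3.3 [cite: Palasek2026ElementaryModel, §3.3]; T. Kato,
*Strong `L^p` solutions of the Navier–Stokes equation in `ℝ^m`*, Math. Z. 187 (1984) 471–480
[cite: Kato1984, Thm. 2] (the hypothesis).
-/

noncomputable section

namespace Summit.NavierStokesRegularity.EpisodeBaseNegative

open Summit.NavierStokesRegularity.FluidComputer.PalasekTowerClayBridge

/-- **THE ∀-PLACEHOLDER `FirstEpisodeR` IS FALSE MODULO THE SMALL-DATA ENGINE.** For every tiny
anchored level-`0` host (they exist: `TinyBlob.tinyAnchoredHosts_holds`) the engine continues the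
datum classically through the first window with speed `< Y₁`, and forced Serrin–Masuda uniqueness
identifies any alleged level-`1` stage with it — contradicting the level-`1` speed floor.
[cite: Palasek2026ElementaryModel, §3.3] -/
theorem firstEpisodeR_false_of_engine (hE : SmallDataClassicalEngine 1) : ¬ FirstEpisodeR :=
  firstEpisodeR_false_of_engine_of_tinyHosts hE TinyBlob.tinyAnchoredHosts_holds

/-- … hence `FirstEpisode` is false modulo the engine. [cite: Palasek2026ElementaryModel, §3.3] -/
theorem firstEpisode_false_of_engine (hE : SmallDataClassicalEngine 1) : ¬ FirstEpisode :=
  firstEpisode_false_of_engine_of_tinyHosts hE TinyBlob.tinyAnchoredHosts_holds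

/-- … and so is `HeredityAt 0`. [cite: Palasek2026ElementaryModel, §3.3] -/
theorem heredityAt_zero_false_of_engine (hE : SmallDataClassicalEngine 1) : ¬ HeredityAt 0 :=
  heredityAt_zero_false_of_engine_of_tinyHosts hE TinyBlob.tinyAnchoredHosts_holds

end Summit.NavierStokesRegularity.EpisodeBaseNegative

end
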